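import Summits.Ventures.QEC.Census.CSSNormalFormSAT.BooleanNormalForm
import Summits.Ventures.QEC.Census.CSSNormalFormSAT.EncodeSoundSym
import HarnessLib

/-!
# Census cell `(16,1)` in the kernel, ASSEMBLED MODULO the two outstanding inputs (KERNEL-PLAN item 5)

`cssUpperNF_16_1_of`: IF (H3b) every Boolean matrix with `ZCond ∧ XCond` at `(16,5,b,w)` has a double-lex representative
(`∃ P', ZCond ∧ XCond ∧ LexCond` — KERNEL-PLAN item 3b) and (HnoNF) no Boolean normal form exists for `8 ≤ b ≤ 11`, `5 ≤ w ≤ 16 − b`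
(the ten `noNF_16_5_b<b>_w<w>`; seven are in the tree, `(8,6)`, `(9,5)`, `(8,5)` are data still being filed), THEN every CSS code on 16
qubits with `k = 1` has `min dX dZ ≤ 4`. Proof: by contradiction `dX, dZ ≥ 5`; WLOG `rank H^Z ≥ rank H^X` (`CSSCode.swap`); `k = 1` gives
`rank H^X + rank H^Z = 15`, so `b = rank H^Z ≥ 8`; `boolean_normalForm_of_css` gives `w` with `5 ≤ w ≤ 16 − b` (so `b ≤ 11`) and a matrix
with `ZCond ∧ XCond`; (H3b) adds `LexCond`; (HnoNF) refutes. Both hypotheses are explicit `Prop`s — discharging them closes the cell. [folklore]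
-/

set_option autoImplicit false

namespace Summit.Ventures.QEC.Census.CSSNormalFormSAT

open Literature.InformationTheory.QuantumCodes NFEnc

/-- Item 3b as a proposition: double-lex representatives exist. (definition) -/
def DoubleLexHyp : Prop :=
  ∀ (b w : ℕ) (P : ℕ → ℕ → Bool), ZCond ⟨16, 5, b, w⟩ P → XCond ⟨16, 5, b, w⟩ P →
    ∃ P' : ℕ → ℕ → Bool, ZCond ⟨16, 5, b, w⟩ P' ∧ XCond ⟨16, 5, b, w⟩ P' ∧ LexCond ⟨16, 5, b, w⟩ P'

/-- The ten refutations as a proposition (seven landed as `noNF_16_5_b*_w*`; `(8,6)`, `(9,5)`, `(8,5)` pending data). (definition) -/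
def NoNFHyp : Prop :=
  ∀ (b w : ℕ), 8 ≤ b → b ≤ 11 → 5 ≤ w → w ≤ 16 - b →
    ∀ P : ℕ → ℕ → Bool, ZCond ⟨16, 5, b, w⟩ P → XCond ⟨16, 5, b, w⟩ P → LexCond ⟨16, 5, b, w⟩ P → False

/-- The one-sided step: a code with `rank H^Z ≥ rank H^X`, `k = 1`, `dX, dZ ≥ 5` is impossible under the two hypotheses. [folklore] -/
theorem false_of_rankZ_ge {RX RZ : Type} [Fintype RX] [Fintype RZ] (h3b : DoubleLexHyp) (hno : NoNFHyp)
    (C : CSSCode RX RZ (Fin 16)) (hk : C.k = 1) (hX5 : 5 ≤ C.dX) (hZ5 : 5 ≤ C.dZ) (hr : C.HX.rank ≤ C.HZ.rank) : False := by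
  obtain ⟨b, w, A', hb, hw5, hwm, hZ, hX⟩ := boolean_normalForm_of_css C hk hX5 hZ5
  have hkeq := C.k_eq
  rw [hk, Fintype.card_fin] at hkeq
  have hle := C.rank_HX_add_rank_HZ_le
  rw [Fintype.card_fin] at hle
  have hb8 : 8 ≤ b := by rw [hb]; omega
  have hb11 : b ≤ 11 := by omega
  obtain ⟨P', hZ', hX', hL'⟩ := h3b b w _ hZ hX
  exact hno b w hb8 hb11 hw5 hwm P' hZ' hX' hL'

/-- **Census cell `(16,1)` modulo (H3b), (HnoNF)**: `k = 1 ⇒ min dX dZ ≤ 4` at `n = 16`. [folklore] -/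
theorem cssUpperNF_16_1_of (h3b : DoubleLexHyp) (hno : NoNFHyp) {RX RZ : Type} [Fintype RX] [Fintype RZ]
    (C : CSSCode RX RZ (Fin 16)) (hk : C.k = 1) : min C.dX C.dZ ≤ 4 := by
  by_contra hlt
  have hX5 : 5 ≤ C.dX := by
    have := min_le_left C.dX C.dZ; omega
  have hZ5 : 5 ≤ C.dZ := by
    have := min_le_right C.dX C.dZ; omega
  by_cases hr : C.HX.rank ≤ C.HZ.rank
  · exact false_of_rankZ_ge h3b hno C hk hX5 hZ5 hr
  · refine false_of_rankZ_ge h3b hno C.swap (by rw [CSSCode.k_swap]; exact hk) ?_ ?_ ?_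
    · rw [CSSCode.dX_swap]; exact hZ5
    · rw [CSSCode.dZ_swap]; exact hX5
    · rw [CSSCode.swap_HX, CSSCode.swap_HZ]; omega

end Summit.Ventures.QEC.Census.CSSNormalFormSAT
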